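import Mathlib
import HarnessLib
import Summits.AtomisticToContinuum.Crystallization.Theorems.PricedLinkCensusSoftFourRingsTwoBlocksC
import Summits.AtomisticToContinuum.Crystallization.Theorems.PricedLinkCensusSoftFourRingsThreeBlocks
import Summits.AtomisticToContinuum.Crystallization.Theorems.PricedLinkCensusSoftFourRingsNoSlackPrep

/-!
# Soft four-rings: there are no slack triangles

Support file for `SoftFourRings` (route `PricedLinkCensus`, sub-problem `Crystallization`),
conditional on Tammes-13.

`no_slack_one_percent` : for twelve unit vectors with pairwise angles `≥ 2 arcsin (1/2.02)` and
`24` bonds (angles `≤ 2 arcsin (1.01/2)`), four at every point, the hull triangulation has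
exactly `8` bond triangles and every vertex lies in exactly `2` of them (so the remaining cells
are `6` quadrilaterals, possibly folded).  Proof: by `tight_counts_one_percent` the number of
slack triangles `s` satisfies `#V₃ = 3 s ≤ 12`; `s = 1` and `s = 4` are immediate, `s = 2` is
`no_two_blocks`, `s = 3` is `no_three_blocks`; so `s = 0`, `V₃ = ∅`, `3 T = 24`.
-/

namespace Summit.AtomisticToContinuum.Crystallization.Theorems

open Real RealInnerProductSpace Literature.Geometry.DiscreteGeometry

section Setting

variable {X : Finset (EuclideanSpace ℝ (Fin 3))} {B : Finset (Finset (EuclideanSpace ℝ (Fin 3)))}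
  (hT : musinTarasov2012_tammes_thirteen) (hX1 : ∀ y ∈ X, ‖y‖ = 1) (hcard : X.card = 12)
  (hsepX : ∀ u ∈ X, ∀ u' ∈ X, u ≠ u' → ⟪u, u'⟫ ≤ 1 - 1 / (2 * (101 / 100 : ℝ) ^ 2))
  (hB : ∀ T ∈ B, ∃ u ∈ X, ∃ u' ∈ X, u ≠ u' ∧ 1 - (101 / 100 : ℝ) ^ 2 / 2 ≤ ⟪u, u'⟫ ∧ T = {u, u'})
  (hBcard : B.card = 24)
  (hdeg : ∀ v ∈ X, ∃ w : Fin 4 → EuclideanSpace ℝ (Fin 3), (∀ k, w k ∈ X) ∧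
    Function.Injective w ∧ (∀ k, w k ≠ v) ∧
    (∀ k, ({v, w k} : Finset (EuclideanSpace ℝ (Fin 3))) ∈ B) ∧
    ∀ y, ({v, y} : Finset (EuclideanSpace ℝ (Fin 3))) ∈ B → ∃ k, y = w k)

include hT hX1 hcard hsepX hB hBcard hdeg in
open scoped Classical in
/-- **No slack triangles at one percent** (conditional on Tammes-13): `T = 8` bond triangles and
`t_v = 2` at every vertex. -/
theorem no_slack_one_percent :
    ((facetNormals X).filter (fun c => (tightSet X c).card = 3 ∧
        ((edgesOfFacet X c).filter (fun T => T ∉ B)).card = 0)).card = 8 ∧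
    ∀ v ∈ X, ((facetNormals X).filter (fun c => v ∈ tightSet X c ∧ (tightSet X c).card = 3 ∧
        ((edgesOfFacet X c).filter (fun T => T ∉ B)).card = 0)).card = 2 := by
  obtain ⟨hC6, hC1, -, hC3, -⟩ := tight_counts_one_percent hT hX1 hcard hsepX hB hBcard hdeg
  obtain ⟨hV3eq, hdis, hV3card⟩ := slack_partition hT hX1 hcard hsepX hB hBcard hdeg
  -- it suffices to exclude vertices with three bond triangles
  suffices hV0 : ∀ v ∈ X, ((facetNormals X).filter (fun c => v ∈ tightSet X c ∧ (tightSet X c).card = 3 ∧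
        ((edgesOfFacet X c).filter (fun T => T ∉ B)).card = 0)).card ≠ 3 by
    have hempty : (X.filter (fun v => ((facetNormals X).filter (fun c => v ∈ tightSet X c ∧ (tightSet X c).card = 3 ∧
        ((edgesOfFacet X c).filter (fun T => T ∉ B)).card = 0)).card = 3)) = ∅ :=
      Finset.filter_eq_empty_iff.2 (fun v hv => hV0 v hv)
    rw [hempty, Finset.card_empty, add_zero] at hC6
    refine ⟨by omega, fun v hv => ?_⟩
    rcases hC1 v hv with h | h
    · exact h
    · exact absurd h (hV0 v hv)
  intro v0 hv0 htv0
  set SF := ((facetNormals X).filter (fun c => (tightSet X c).card = 3 ∧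
      ((edgesOfFacet X c).filter (fun T => T ∉ B)).card = 2)) with hSF
  set V3 := (X.filter (fun v => ((facetNormals X).filter (fun c => v ∈ tightSet X c ∧ (tightSet X c).card = 3 ∧
        ((edgesOfFacet X c).filter (fun T => T ∉ B)).card = 0)).card = 3)) with hV3
  have hv0V : v0 ∈ V3 := Finset.mem_filter.2 ⟨hv0, htv0⟩
  have hV3X : V3 ⊆ X := Finset.filter_subset _ _
  have hs4 : SF.card ≤ 4 := by
    have := Finset.card_le_card hV3X; rw [hcard, hV3card] at this; omega
  have hs1 : 1 ≤ SF.card := by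
    have := Finset.card_pos.2 ⟨v0, hv0V⟩; rw [hV3card] at this; omega
  have hrV : ∀ {y}, y ∈ X → ((facetNormals X).filter (fun c => y ∈ tightSet X c ∧ (tightSet X c).card = 3 ∧
        ((edgesOfFacet X c).filter (fun T => T ∉ B)).card = 0)).card = 3 → y ∈ V3 :=
    fun hy ht => Finset.mem_filter.2 ⟨hy, ht⟩
  -- block data of a slack triangle
  have hdata : ∀ f ∈ SF, ∃ a b c p q u w m n r : EuclideanSpace ℝ (Fin 3),
      tightSet X f = {a, b, c} ∧ (a ∈ X ∧ b ∈ X ∧ c ∈ X ∧ a ≠ c ∧ b ≠ c) ∧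
      ((p ∈ X ∧ q ∈ X ∧ u ∈ X ∧ w ∈ X ∧ m ∈ X ∧ n ∈ X ∧ r ∈ X) ∧
      (∀ y, ({a, y} : Finset (EuclideanSpace ℝ (Fin 3))) ∈ B ↔ (y = p ∨ y = u ∨ y = r ∨ y = b)) ∧
      (∀ y, ({b, y} : Finset (EuclideanSpace ℝ (Fin 3))) ∈ B ↔ (y = q ∨ y = w ∨ y = r ∨ y = a)) ∧
      (∀ y, ({c, y} : Finset (EuclideanSpace ℝ (Fin 3))) ∈ B ↔ (y = p ∨ y = n ∨ y = m ∨ y = q)) ∧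
      (∀ y, ({r, y} : Finset (EuclideanSpace ℝ (Fin 3))) ∈ B ↔ (y = u ∨ y = a ∨ y = b ∨ y = w)) ∧
      (({p, u} : Finset (EuclideanSpace ℝ (Fin 3))) ∈ B ∧
        ({u, r} : Finset (EuclideanSpace ℝ (Fin 3))) ∈ B ∧
        ({r, b} : Finset (EuclideanSpace ℝ (Fin 3))) ∈ B ∧
        ({q, w} : Finset (EuclideanSpace ℝ (Fin 3))) ∈ B ∧
        ({w, r} : Finset (EuclideanSpace ℝ (Fin 3))) ∈ B ∧
        ({p, n} : Finset (EuclideanSpace ℝ (Fin 3))) ∈ B ∧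
        ({n, m} : Finset (EuclideanSpace ℝ (Fin 3))) ∈ B ∧
        ({m, q} : Finset (EuclideanSpace ℝ (Fin 3))) ∈ B) ∧
      (({p, r} : Finset (EuclideanSpace ℝ (Fin 3))) ∉ B ∧
        ({u, b} : Finset (EuclideanSpace ℝ (Fin 3))) ∉ B ∧
        ({p, b} : Finset (EuclideanSpace ℝ (Fin 3))) ∉ B ∧
        ({q, r} : Finset (EuclideanSpace ℝ (Fin 3))) ∉ B ∧
        ({w, a} : Finset (EuclideanSpace ℝ (Fin 3))) ∉ B ∧
        ({q, a} : Finset (EuclideanSpace ℝ (Fin 3))) ∉ B ∧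
        ({p, m} : Finset (EuclideanSpace ℝ (Fin 3))) ∉ B ∧
        ({n, q} : Finset (EuclideanSpace ℝ (Fin 3))) ∉ B ∧
        ({p, q} : Finset (EuclideanSpace ℝ (Fin 3))) ∉ B ∧
        ({u, w} : Finset (EuclideanSpace ℝ (Fin 3))) ∉ B) ∧
      ((p ≠ u ∧ p ≠ r ∧ p ≠ b ∧ u ≠ r ∧ u ≠ b ∧ r ≠ b) ∧
        (q ≠ w ∧ q ≠ r ∧ q ≠ a ∧ w ≠ r ∧ w ≠ a ∧ r ≠ a) ∧
        (p ≠ n ∧ p ≠ m ∧ p ≠ q ∧ n ≠ m ∧ n ≠ q ∧ m ≠ q) ∧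
        (u ≠ a ∧ u ≠ b ∧ u ≠ w ∧ a ≠ b ∧ a ≠ w ∧ b ≠ w) ∧ r ≠ c) ∧
      (∀ y, ({p, y} : Finset (EuclideanSpace ℝ (Fin 3))) ∈ B ↔ (y = a ∨ y = u ∨ y = c ∨ y = n)) ∧
      (∀ y, ({q, y} : Finset (EuclideanSpace ℝ (Fin 3))) ∈ B ↔ (y = b ∨ y = w ∨ y = c ∨ y = m))) ∧
      (((facetNormals X).filter (fun c => r ∈ tightSet X c ∧ (tightSet X c).card = 3 ∧
        ((edgesOfFacet X c).filter (fun T => T ∉ B)).card = 0)).card = 3 ∧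
       ((facetNormals X).filter (fun c => p ∈ tightSet X c ∧ (tightSet X c).card = 3 ∧
        ((edgesOfFacet X c).filter (fun T => T ∉ B)).card = 0)).card = 2 ∧
       ((facetNormals X).filter (fun c => q ∈ tightSet X c ∧ (tightSet X c).card = 3 ∧
        ((edgesOfFacet X c).filter (fun T => T ∉ B)).card = 0)).card = 2) ∧ r ∉ tightSet X f := by
    intro f hf
    obtain ⟨hfF, hf3, hfnb⟩ := Finset.mem_filter.1 hf
    exact slack_block_data hT hX1 hcard hsepX hB hBcard hdeg hfF hf3 hfnb
  have hV3mem : ∀ f ∈ SF, ∀ y ∈ tightSet X f, ((facetNormals X).filter (fun c => y ∈ tightSet X c ∧ (tightSet X c).card = 3 ∧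
        ((edgesOfFacet X c).filter (fun T => T ∉ B)).card = 0)).card = 3 := by
    intro f hf y hy
    obtain ⟨hfF, hf3, hfnb⟩ := Finset.mem_filter.1 hf
    exact hC3 f hfF hf3 hfnb y hy
  have hs : SF.card = 1 ∨ SF.card = 2 ∨ SF.card = 3 ∨ SF.card = 4 := by omega
  rcases hs with hs | hs | hs | hs
  · -- one slack triangle: its apex `r` has nowhere to go
    obtain ⟨f1, hSF1⟩ := Finset.card_eq_one.1 hs
    have hf1 : f1 ∈ SF := by rw [hSF1]; simp
    obtain ⟨a1, b1, c1, p1, q1, u1, w1, m1, n1, r1, -, -, hblk1, ⟨htr1, -, -⟩, hr1T⟩ := hdata f1 hf1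
    have h := hrV hblk1.1.2.2.2.2.2.2 htr1
    rw [hV3eq, hSF1, Finset.singleton_biUnion] at h
    exact hr1T h
  · -- two slack triangles
    obtain ⟨f1, f2, hne, hSF12⟩ := Finset.card_eq_two.1 hs
    have hf1 : f1 ∈ SF := by rw [hSF12]; simp
    have hf2 : f2 ∈ SF := by rw [hSF12]; simp
    obtain ⟨a1, b1, c1, p1, q1, u1, w1, m1, n1, r1, hT1, ⟨ha1, hb1, hc1, hac1, hbc1⟩, hblk1,
      ⟨htr1, htp1, htq1⟩, hr1T⟩ := hdata f1 hf1
    obtain ⟨a2, b2, c2, p2, q2, u2, w2, m2, n2, r2, hT2, ⟨ha2, hb2, hc2, hac2, hbc2⟩, hblk2,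
      ⟨htr2, htp2, htq2⟩, hr2T⟩ := hdata f2 hf2
    have hV3u : V3 = tightSet X f1 ∪ tightSet X f2 := by
      rw [hV3eq, hSF12, Finset.biUnion_insert, Finset.singleton_biUnion]
    have hr1 : r1 = a2 ∨ r1 = b2 ∨ r1 = c2 := by
      have h := hrV hblk1.1.2.2.2.2.2.2 htr1
      rw [hV3u, Finset.mem_union] at h
      rcases h with h | h
      · exact absurd h hr1T
      · rw [hT2] at h; simpa using h
    have hr2 : r2 = a1 ∨ r2 = b1 ∨ r2 = c1 := by
      have h := hrV hblk2.1.2.2.2.2.2.2 htr2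
      rw [hV3u, Finset.mem_union] at h
      rcases h with h | h
      · rw [hT1] at h; simpa using h
      · exact absurd h hr2T
    have hd12 : ∀ y, (y = a1 ∨ y = b1 ∨ y = c1) → ¬ (y = a2 ∨ y = b2 ∨ y = c2) := by
      intro y hy hy'
      have hd := hdis f1 hf1 f2 hf2 hne
      rw [hT1, hT2, Finset.disjoint_left] at hd
      have hy1 : y ∈ ({a1, b1, c1} : Finset (EuclideanSpace ℝ (Fin 3))) := by
        rcases hy with rfl | rfl | rfl <;> simp
      have hy2 : y ∈ ({a2, b2, c2} : Finset (EuclideanSpace ℝ (Fin 3))) := by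
        rcases hy' with rfl | rfl | rfl <;> simp
      exact hd hy1 hy2
    have hm1 := hV3mem f1 hf1
    have hm2 := hV3mem f2 hf2
    rw [hT1] at hm1
    rw [hT2] at hm2
    have hVa1 := hm1 a1 (by simp)
    have hVb1 := hm1 b1 (by simp)
    have hVc1 := hm1 c1 (by simp)
    have hVa2 := hm2 a2 (by simp)
    have hVb2 := hm2 b2 (by simp)
    have hVc2 := hm2 c2 (by simp)
    have hVp1 : ¬ ((facetNormals X).filter (fun c => p1 ∈ tightSet X c ∧ (tightSet X c).card = 3 ∧
        ((edgesOfFacet X c).filter (fun T => T ∉ B)).card = 0)).card = 3 := by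
      intro h; omega
    have hVq1 : ¬ ((facetNormals X).filter (fun c => q1 ∈ tightSet X c ∧ (tightSet X c).card = 3 ∧
        ((edgesOfFacet X c).filter (fun T => T ∉ B)).card = 0)).card = 3 := by
      intro h; omega
    have hVp2 : ¬ ((facetNormals X).filter (fun c => p2 ∈ tightSet X c ∧ (tightSet X c).card = 3 ∧
        ((edgesOfFacet X c).filter (fun T => T ∉ B)).card = 0)).card = 3 := by
      intro h; omega
    have hVq2 : ¬ ((facetNormals X).filter (fun c => q2 ∈ tightSet X c ∧ (tightSet X c).card = 3 ∧
        ((edgesOfFacet X c).filter (fun T => T ∉ B)).card = 0)).card = 3 := by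
      intro h; omega
    exact no_two_blocks hB hcard hdeg ha1 hb1 hc1 ha2 hb2 hc2 hblk1 hblk2
      (V3 := fun y => ((facetNormals X).filter (fun c => y ∈ tightSet X c ∧ (tightSet X c).card = 3 ∧
        ((edgesOfFacet X c).filter (fun T => T ∉ B)).card = 0)).card = 3)
      hVa1 hVb1 hVc1 hVa2 hVb2 hVc2 hVp1 hVq1 hVp2 hVq2 hd12 hac1 hbc1 hac2 hbc2 hr1 hr2
  · -- three slack triangles
    obtain ⟨f1, f2, f3, h12, h13, h23, hSF123⟩ := Finset.card_eq_three.1 hs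
    have hf1 : f1 ∈ SF := by rw [hSF123]; simp
    have hf2 : f2 ∈ SF := by rw [hSF123]; simp
    have hf3 : f3 ∈ SF := by rw [hSF123]; simp
    obtain ⟨a1, b1, c1, p1, q1, u1, w1, m1, n1, r1, hT1, ⟨ha1, hb1, -, hac1, hbc1⟩, hblk1,
      ⟨htr1, htp1, htq1⟩, -⟩ := hdata f1 hf1
    obtain ⟨a2, b2, c2, p2, q2, u2, w2, m2, n2, r2, hT2, ⟨-, -, -, hac2, hbc2⟩, hblk2,
      ⟨-, htp2, htq2⟩, -⟩ := hdata f2 hf2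
    obtain ⟨a3, b3, c3, p3, q3, u3, w3, m3, n3, r3, hT3, ⟨-, -, -, hac3, hbc3⟩, hblk3,
      ⟨-, htp3, htq3⟩, -⟩ := hdata f3 hf3
    have hdj : ∀ {f f' : EuclideanSpace ℝ (Fin 3)} {x y z x' y' z' : EuclideanSpace ℝ (Fin 3)},
        f ∈ SF → f' ∈ SF → f ≠ f' → tightSet X f = {x, y, z} → tightSet X f' = {x', y', z'} →
        ∀ t, (t = x ∨ t = y ∨ t = z) → ¬ (t = x' ∨ t = y' ∨ t = z') := by
      intro f f' x y z x' y' z' hf hf' hne hTf hTf' t ht ht'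
      have hd := hdis f hf f' hf' hne
      rw [hTf, hTf', Finset.disjoint_left] at hd
      have ht1 : t ∈ ({x, y, z} : Finset (EuclideanSpace ℝ (Fin 3))) := by
        rcases ht with rfl | rfl | rfl <;> simp
      have ht2 : t ∈ ({x', y', z'} : Finset (EuclideanSpace ℝ (Fin 3))) := by
        rcases ht' with rfl | rfl | rfl <;> simp
      exact hd ht1 ht2
    set N0 := X \ V3 with hN0
    have hN0X : N0 ⊆ X := Finset.sdiff_subset
    have hN0card : N0.card = 3 := by
      rw [hN0, Finset.card_sdiff_of_subset hV3X, hcard, hV3card, hs]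
    have hpN : ∀ {y}, y ∈ X → ((facetNormals X).filter (fun c => y ∈ tightSet X c ∧ (tightSet X c).card = 3 ∧
        ((edgesOfFacet X c).filter (fun T => T ∉ B)).card = 0)).card = 2 → y ∈ N0 := by
      intro y hy ht
      refine Finset.mem_sdiff.2 ⟨hy, fun hv => ?_⟩
      have := (Finset.mem_filter.1 hv).2
      omega
    have hvN : ∀ {y}, y ∈ X → ((facetNormals X).filter (fun c => y ∈ tightSet X c ∧ (tightSet X c).card = 3 ∧
        ((edgesOfFacet X c).filter (fun T => T ∉ B)).card = 0)).card = 3 → y ∉ N0 :=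
      fun hy ht h => (Finset.mem_sdiff.1 h).2 (Finset.mem_filter.2 ⟨hy, ht⟩)
    have hm1 := hV3mem f1 hf1
    rw [hT1] at hm1
    have hV : ∀ y ∈ X, y ∉ N0 → (y = a1 ∨ y = b1 ∨ y = c1) ∨ (y = a2 ∨ y = b2 ∨ y = c2) ∨
        (y = a3 ∨ y = b3 ∨ y = c3) := by
      intro y hy hyN
      have hyV : y ∈ V3 := by
        by_contra h
        exact hyN (Finset.mem_sdiff.2 ⟨hy, h⟩)
      rw [hV3eq, hSF123, Finset.biUnion_insert, Finset.biUnion_insert, Finset.singleton_biUnion,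
        Finset.mem_union, Finset.mem_union, hT1, hT2, hT3] at hyV
      simpa using hyV
    exact no_three_blocks hdeg hblk1 hblk2 hblk3 hac1 hbc1 hac2 hbc2 hac3 hbc3
      (hdj hf1 hf2 h12 hT1 hT2) (hdj hf1 hf3 h13 hT1 hT3) (hdj hf2 hf3 h23 hT2 hT3) hN0X hN0card
      (hpN hblk1.1.1 htp1) (hpN hblk1.1.2.1 htq1) (hpN hblk2.1.1 htp2) (hpN hblk2.1.2.1 htq2)
      (hpN hblk3.1.1 htp3) (hpN hblk3.1.2.1 htq3) (hvN ha1 (hm1 a1 (by simp)))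
      (hvN hb1 (hm1 b1 (by simp))) (hvN hblk1.1.2.2.2.2.2.2 htr1) hV
  · -- four slack triangles: every vertex would have three bond triangles
    have hV3X' : V3 = X :=
      Finset.eq_of_subset_of_card_le hV3X (by rw [hcard, hV3card, hs])
    obtain ⟨f1, hf1⟩ : SF.Nonempty := Finset.card_pos.1 (by omega)
    obtain ⟨a1, b1, c1, p1, q1, u1, w1, m1, n1, r1, -, -, hblk1, ⟨-, htp1, -⟩, -⟩ := hdata f1 hf1
    have hp : p1 ∈ V3 := by rw [hV3X']; exact hblk1.1.1
    have := (Finset.mem_filter.1 hp).2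
    omega

end Setting

end Summit.AtomisticToContinuum.Crystallization.Theorems
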